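import Summits.BirchSwinnertonDyer.BirchSwinnertonDyer.Theorems.PrintCf2SplitBadTwoLocalControlKernelInertia
import Summits.BirchSwinnertonDyer.BirchSwinnertonDyer.Theorems.PrintCf2SplitBadTwoRestrictedSelmerCoinvariantsVanish
import Literature.NumberTheory.EllipticCurves.SubgroupSelmerCocycleCriteriaProofs
import HarnessLib

/-!
# Crux `PrintCf2.SplitBadTwoRankOneOfFacts` (stmt-BirchSwinnertonDyer-20368), road α v10.2 — brick B15 §2:
# THE KERNEL OF CONTROL IS ZERO EXACTLY as soon as one additive place `w ∤ 2` does not split completely in the first layer of the line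

Cell `bsd-print-cf2`, width seat `bsd-line-cf2-p1-w6` g2 (prover-bsd-line-cf2-p1-w6-g2-0); brick «B15 §2 KERNEL-EXACT» of the memo
`Cruxes/SplitBadTwoRankOneOfFacts/B15-DYADIC-EXACT-w2g9.md` §2 (-w2 g9); `--supports stmt-BirchSwinnertonDyer-20368` (helper, Theses-free).
HONEST FRAMING: nothing here closes the crux or a registered stub; BSD is not proved by any of this; no summit statement is proved by
this seat. No definition, no named fact, no `sorry`.

WHAT. In the four-index identity of the registered stub S3c₂ `stub_restrictedEulerCharBottom_two` (skeleton of record v10.2), -w7 p652120 /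
LEAD g11 p657357 `control_identity_of_frame_of_noFiniteSubmodule`, the KERNEL term
`ker = 𝔖_{v̄}(K, W*) ⊓ ker (res : H¹(K, W*) → H¹(K*_∞, W*))` was bounded by ONE factor of `2` (LEAD p656507:
`ker res = H¹(Γ, W*(K*_∞)) = Hom(Γ, W*[2])` has order `2`). THIS FILE shows the non-zero class of `Hom(Γ, W*[2])` is NEVER in
`𝔖_{v̄}(K, W*)` once some additive place `w ∤ 2` of `K` (the place `w₇` above `7` on every frame) does not split completely in the
first layer `K₁` of the line — so the kernel term is `0` EXACTLY:
* §1 `oneCocycleClass_eq_zero_of_principal_on` (ABSTRACT, any topological group `G`, discrete `G`-module `M`, subgroups `I ≤ N`,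
  `I ≤ D`, an element `δ ∈ D` generating `G` topologically together with `N`, and `M^I ⊆ M^G`): a continuous cocycle that is
  principal on `N` AND principal on `D` is principal. Proof: subtract the `N`-coboundary; the corrected cocycle `z′` vanishes on `N`
  and is `∂c` on `D`; `z′|_I = 0` makes `c ∈ M^I ⊆ M^G`, so `z′|_D = 0`, so `z′(δ) = 0`, so `z′ = 0` (tree
  `ResKernel.eq_zero_of_apply_eq_zero`: its zero set is an open subgroup containing `N` and `δ`).
* §2 (any number field `K`, any `p`, any `ℤ_p`-extension `κ`, any discrete `Γ_K`-module `M` with continuous orbit maps, any finite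
  place `w` with `I_w ≤ ker κ` and `M^{I_w} ⊆ M^{Γ_K}`): **if `w` does not split completely in the first layer**
  (`¬ D_w ≤ κ.layerSubgroup 1`, i.e. some `δ ∈ D_w` has `κ δ ∈ ℤ_pˣ` — `exists_mem_isTopGenerator_unitTwist_of_not_le_layerSubgroup_one`), **a class of
  `H¹(K, M)` dying on `ker κ` and locally trivial at `w` is `0`** (`eq_zero_of_resOfLe_kerSubgroup_eq_zero_of_resOfLe_decomp_eq_zero`);
  hence `𝔖_𝔮(K, M) ⊓ ker res = ⊥` for every `𝔮` with `w ∤ p` (`restrictedSelmerBase_inf_ker_resOfLe_eq_bot`).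
* §3 ROAD α (`M = W* = ↥((W.baseChange K).endEigenPrimaryTorsion 2 π r)`, `p = 2`): at an ADDITIVE `w ∤ 2` the hypothesis
  `M^{I_w} ⊆ M^{Γ_K}` HOLDS (`W*^{I_w} = W*[2]` is fixed pointwise by `Γ_K ∋ √−7`: -w3 g7 p657641 ENGINE
  `smul_eq_self_of_mem_fixedPoints_of_natCard_le_four`), so on every S3c₂ frame (member `C • W = cm7^{(d)}`, `K` imaginary quadratic,
  `v̄ ∣ 2`, `π² = π − 2`, `r² = r − 2`, `κ′` unramified outside `v̄`, `γ′`): **if the place `w₇ ∣ 7` does not split completely in the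
  first layer of `κ′` then `𝔖_{v̄}(K, W*) ⊓ ker res = ⊥`, `#ker = 1`, `v₂ #ker = 0`** (`ker_control_of_frame_eq_bot`,
  `natCard_ker_control_of_frame_eq_one`), and LEAD's collapsed identity reads
  **`n = v₂ #𝔖_{v̄}(K, W*) + v₂ [𝔖^Γ : res 𝔖_{v̄}(K, W*)]`** (`control_identity_of_frame_of_not_decomp_le`).
  The displayed hypothesis is (H7) of the memo: for THE line `K*_∞` of `K = ℚ(√−7)` it holds by class field theory (`K₁ = K(√−ᾱ₀)`
  and `−ᾱ₀ ≡ 3 (mod w₇)` is a non-square), which is NOT proved here (no global class field theory in the tree; see the memo §1 (C2)).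
presearch: Agboola 2007 §3 Prop. 3.2 (arXiv:math/0602192 p0008), Greenberg LNM 1716 §3 Lemmas 3.1–3.3 (PDF pp. 86–88), Serre *Galois
Cohomology* I §2.6 (inflation–restriction), Neukirch ANT II (9.9) — all held; no new Literature fact filed. beyond-print theorem: no.

References: [Agboola2007] §3 Prop. 3.2; [GreenbergLNM1716] §3 Lemmas 3.1, 3.3; [SerreGaloisCohomology1997] I §2.6, I §5.1;
[NeukirchANT1999] Ch. II (9.9); [Washington1997] §13.1.
-/

noncomputable section

open scoped Classical

set_option linter.dupNamespace false
set_option autoImplicit false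

open NumberField IsDedekindDomain Field WeierstrassCurve
open Literature.NumberTheory.EllipticCurves Literature.NumberTheory.EllipticCurves.GreenbergSelmer
open Literature.NumberTheory.EllipticCurves.Agboola2007
open Literature.NumberTheory.EllipticCurves.IwasawaDual
open Literature.NumberTheory.EllipticCurves.ResKernel
open Literature.NumberTheory.GaloisRepresentations

universe u

namespace Summit.BirchSwinnertonDyer.BirchSwinnertonDyer.Theorems.PrintCf2.RestrictedSelmerPair

/-! ## §1. ABSTRACT: a cocycle principal on `N` and on `D` is principal, when `N, δ ∈ D` generate and `M^I ⊆ M^G` -/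

section Abstract

variable {G : Type u} [Group G] [TopologicalSpace G] [IsTopologicalGroup G]
  {M : Type u} [AddCommGroup M] [DistribMulAction G M] [TopologicalSpace M] [DiscreteTopology M]

/-- **ABSTRACT KERNEL-EXACT LEMMA.** `G` a topological group, `M` a discrete `G`-module with continuous orbit maps, `N, D, I`
subgroups with `I ≤ N`, `I ≤ D`, every `I`-fixed element of `M` fixed by all of `G`, and `δ ∈ D` such that every open subgroup
containing `N` and `δ` is `G`. Then a continuous `1`-cocycle `z` which is principal on `N` (`z n = n•a − a`) and principal on `D`
(`z d = d•b − b`) has trivial class: `z − ∂a` vanishes on `N`, equals `∂(b − a)` on `D`, its vanishing on `I` puts `b − a` in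
`M^I ⊆ M^G`, so it vanishes on `D ∋ δ`, hence everywhere. (Inflation–restriction `ker res_N = H¹(G/N, M^N) = Hom` for a procyclic
quotient acting trivially, read at one local place.) [cite: SerreGaloisCohomology1997, I §2.6 and I §5.1]
[cite: GreenbergLNM1716, §3 Lemma 3.1 (p. 86)] -/
theorem oneCocycleClass_eq_zero_of_principal_on (hcont : ∀ m : M, Continuous fun g : G ↦ g • m)
    (N D I : Subgroup G) (hIN : I ≤ N) (hID : I ≤ D)
    (hfix : ∀ m : M, (∀ i ∈ I, i • m = m) → ∀ g : G, g • m = m)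
    {δ : G} (hδ : δ ∈ D) (hgen : ∀ U : Subgroup G, IsOpen (U : Set G) → N ≤ U → δ ∈ U → U = ⊤)
    (z : contOneCocycles (discreteTopRep G M))
    (hN : ∃ a : M, ∀ n ∈ N, z.1 n = n • a - a) (hD : ∃ b : M, ∀ d ∈ D, z.1 d = d • b - b) :
    oneCocycleClass _ z = 0 := by
  obtain ⟨a, ha⟩ := hN
  obtain ⟨b, hb⟩ := hD
  -- the corrected cocycle `z' = z − ∂a` vanishes on `N` and is `∂(b − a)` on `D`
  have hz'N : ∀ n ∈ N, (z - cobCocycle a (hcont a)).1 n = 0 := fun n hn ↦ by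
    rw [Submodule.coe_sub, ContinuousMap.sub_apply, cobCocycle_apply, ha n hn, sub_self]
  have hz'D : ∀ d ∈ D, (z - cobCocycle a (hcont a)).1 d = d • (b - a) - (b - a) := fun d hd ↦ by
    rw [Submodule.coe_sub, ContinuousMap.sub_apply, cobCocycle_apply, hb d hd, smul_sub]
    abel
  -- `b − a` is `I`-fixed, hence `G`-fixed
  have hI : ∀ i ∈ I, i • (b - a) = b - a := fun i hi ↦ by
    have h := hz'D i (hID hi)
    rw [hz'N i (hIN hi)] at h
    exact (sub_eq_zero.mp h.symm)
  have hG : ∀ g : G, g • (b - a) = b - a := hfix (b - a) hI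
  -- so `z'` vanishes at `δ`, hence everywhere
  have hδ0 : (z - cobCocycle a (hcont a)).1 δ = 0 := by
    rw [hz'D δ hδ, hG δ, sub_self]
  have hzero : z - cobCocycle a (hcont a) = 0 := eq_zero_of_apply_eq_zero N δ hgen _ hz'N hδ0
  have hcl : oneCocycleClass _ (z - cobCocycle a (hcont a)) = oneCocycleClass _ z := by
    rw [oneCocycleClass_sub, oneCocycleClass_cobCocycle, sub_zero]
  rw [← hcl, hzero, oneCocycleClass_zero]

end Abstract

/-! ## §2. `Γ_K`: a class dying on `ker κ` and locally trivial at a non-split unramified place `w` with `M^{I_w} ⊆ M^{Γ_K}` is zero -/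

section Generic

variable {K : Type u} [Field K] [NumberField K] {p : ℕ} [Fact p.Prime] (κ : ZpExtension K p)

omit [NumberField K] in
/-- **(H7) in unit form.** If a subgroup `D ≤ Γ_K` (a decomposition group) is NOT contained in `κ⁻¹(pℤ_p) = Gal(K̄/K₁)` — the place
does not split completely in the first layer `K₁` of the `ℤ_p`-extension — then some `δ ∈ D` has `κ δ ∈ ℤ_pˣ`, i.e. `δ` is a
topological generator of the unit twist `u⁻¹·κ` (same kernel, same layers). [cite: Washington1997, §13.1] -/
theorem exists_mem_isTopGenerator_unitTwist_of_not_le_layerSubgroup_one {D : Subgroup (absoluteGaloisGroup K)}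
    (hD : ¬ D ≤ κ.layerSubgroup 1) :
    ∃ δ ∈ D, ∃ u : ℤ_[p]ˣ, (κ.unitTwist u).IsTopGenerator δ := by
  obtain ⟨δ, hδD, hδ⟩ := SetLike.not_le_iff_exists.mp hD
  rw [ZpExtension.mem_layerSubgroup, pow_one] at hδ
  have hunit : IsUnit (κ δ).toAdd := by
    rw [PadicInt.isUnit_iff]
    exact le_antisymm (PadicInt.norm_le_one _) (not_lt.mp fun h ↦ hδ ((PadicInt.norm_lt_one_iff_dvd _).mp h))
  refine ⟨δ, hδD, hunit.unit⁻¹, ?_⟩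
  show κ.unitTwist hunit.unit⁻¹ δ = Multiplicative.ofAdd 1
  rw [ZpExtension.unitTwist_apply, hunit.val_inv_mul]

/-- **`ker κ` and any `δ` with `κ δ ∈ ℤ_pˣ` generate `Γ_K` topologically** (the tree's `eq_top_of_isOpen_of_kerSubgroup_le` for the
unit twist making `δ` a topological generator; the kernel is twist-invariant). [cite: Washington1997, §13.1] -/
theorem eq_top_of_isOpen_of_kerSubgroup_le_of_unitTwist {δ : absoluteGaloisGroup K} {u : ℤ_[p]ˣ}
    (hδ : (κ.unitTwist u).IsTopGenerator δ) (U : Subgroup (absoluteGaloisGroup K))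
    (hU : IsOpen (U : Set (absoluteGaloisGroup K))) (hN : κ.kerSubgroup ≤ U) (hδU : δ ∈ U) : U = ⊤ :=
  ZpExtension.eq_top_of_isOpen_of_kerSubgroup_le (κ.unitTwist u) hδ U hU
    (by rw [ZpExtension.kerSubgroup_unitTwist]; exact hN) hδU

omit [NumberField K] [Fact p.Prime] in
/-- Transport of topological generation from `Γ_K` to the subgroup `⊤ ≤ Γ_K` (the ambient group of `H¹(K, M) = H¹(⊤, M)` in the
tree's `subgroupH1` currency): if every open subgroup of `Γ_K` containing `N` and `δ` is everything, the same holds in `↥⊤` for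
`N.subgroupOf ⊤` and `⟨δ, _⟩`. [cite: SerreGaloisCohomology1997, I §2.5] -/
theorem eq_top_of_isOpen_subgroupOf_top {N : Subgroup (absoluteGaloisGroup K)} {δ : absoluteGaloisGroup K}
    (hgen : ∀ U : Subgroup (absoluteGaloisGroup K), IsOpen (U : Set (absoluteGaloisGroup K)) → N ≤ U → δ ∈ U → U = ⊤)
    (U : Subgroup ↥(⊤ : Subgroup (absoluteGaloisGroup K))) (hU : IsOpen (U : Set ↥(⊤ : Subgroup (absoluteGaloisGroup K))))
    (hNU : N.subgroupOf ⊤ ≤ U) (hδU : (⟨δ, Subgroup.mem_top δ⟩ : ↥(⊤ : Subgroup (absoluteGaloisGroup K))) ∈ U) :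
    U = ⊤ := by
  set U' : Subgroup (absoluteGaloisGroup K) := U.map (⊤ : Subgroup (absoluteGaloisGroup K)).subtype with hU'def
  have hU' : IsOpen (U' : Set (absoluteGaloisGroup K)) := by
    rw [hU'def, Subgroup.coe_map, Subgroup.coe_subtype]
    have htop : IsOpen (((⊤ : Subgroup (absoluteGaloisGroup K)) : Set (absoluteGaloisGroup K))) := by
      rw [Subgroup.coe_top]; exact isOpen_univ
    exact htop.isOpenMap_subtype_val _ hU
  have hNU' : N ≤ U' := fun g hg ↦
    Subgroup.mem_map.mpr ⟨⟨g, Subgroup.mem_top g⟩, hNU (Subgroup.mem_subgroupOf.mpr hg), rfl⟩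
  have hδU' : δ ∈ U' := Subgroup.mem_map.mpr ⟨⟨δ, Subgroup.mem_top δ⟩, hδU, rfl⟩
  have htop := hgen U' hU' hNU' hδU'
  rw [eq_top_iff]
  intro x _
  have hx : (x : absoluteGaloisGroup K) ∈ U' := by rw [htop]; exact Subgroup.mem_top _
  obtain ⟨y, hyU, hyx⟩ := Subgroup.mem_map.mp hx
  have : y = x := Subtype.ext hyx
  exact this ▸ hyU

variable (M : Type u) [AddCommGroup M] [DistribMulAction (absoluteGaloisGroup K) M]
  [TopologicalSpace M] [DiscreteTopology M] (w : HeightOneSpectrum (𝓞 K))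

/-- **KERNEL-EXACT, GENERIC.** `K` a number field, `κ` a `ℤ_p`-extension, `M` a discrete `Γ_K`-module with continuous orbit maps,
`w` a finite place with `I_w ≤ ker κ` (the line is unramified at `w`) such that **`M^{I_w} ⊆ M^{Γ_K}`** (every `I_w`-fixed element is
fixed by all of `Γ_K`) and **`w` does not split completely in the first layer** (`¬ D_w ≤ κ⁻¹(pℤ_p)`). Then a class
`c ∈ H¹(K, M) = H¹(⊤, M)` which DIES on `ker κ` (`res c = 0` in `H¹(K_∞, M)`) and is LOCALLY TRIVIAL at `w` (`res_{D_w} c = 0`, the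
`𝔖`-condition `awayKer` at `w ∤ p`) is ZERO: by `ker res = H¹(Γ, M^{ker κ})` the class is `[z]` with `z` principal on `ker κ`; local
triviality makes it principal on `D_w`; §1 applies with `N = ker κ`, `D = D_w`, `I = I_w` and a `δ ∈ D_w` with `κ δ ∈ ℤ_pˣ`.
[cite: GreenbergLNM1716, §3 Lemmas 3.1 and 3.3 (pp. 86–88)] [cite: Agboola2007, §3 Prop. 3.2 (arXiv p0008:L128–135)] -/
theorem eq_zero_of_resOfLe_kerSubgroup_eq_zero_of_resOfLe_decomp_eq_zero
    (hcont : ∀ m : M, Continuous fun g : absoluteGaloisGroup K ↦ g • m)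
    (hI : GreenbergSelmer.inertia w ≤ κ.kerSubgroup)
    (hfix : ∀ m : M, (∀ i ∈ GreenbergSelmer.inertia w, i • m = m) → ∀ g : absoluteGaloisGroup K, g • m = m)
    (hsplit : ¬ decomp w ≤ κ.layerSubgroup 1)
    {c : subgroupH1 (⊤ : Subgroup (absoluteGaloisGroup K)) M}
    (hker : resOfLe M (le_top : κ.kerSubgroup ≤ ⊤) c = 0)
    (hloc : resOfLe M (inf_le_left : ⊤ ⊓ decomp w ≤ ⊤) c = 0) : c = 0 := by
  obtain ⟨z, rfl⟩ := oneCocycleClass_surjective _ c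
  obtain ⟨a, ha⟩ := (CocycleCriteria.resOfLe_oneCocycleClass_eq_zero_iff _ z).mp hker
  obtain ⟨b, hb⟩ := (CocycleCriteria.resOfLe_oneCocycleClass_eq_zero_iff _ z).mp hloc
  obtain ⟨δ, hδD, u, hδ⟩ := exists_mem_isTopGenerator_unitTwist_of_not_le_layerSubgroup_one κ hsplit
  refine oneCocycleClass_eq_zero_of_principal_on (G := ↥(⊤ : Subgroup (absoluteGaloisGroup K)))
    (fun m ↦ (hcont m).comp continuous_subtype_val)
    (κ.kerSubgroup.subgroupOf ⊤) ((decomp w).subgroupOf ⊤) ((GreenbergSelmer.inertia w).subgroupOf ⊤)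
    (fun x hx ↦ Subgroup.mem_subgroupOf.mpr (hI (Subgroup.mem_subgroupOf.mp hx)))
    (fun x hx ↦ Subgroup.mem_subgroupOf.mpr (inertia_le_decomp w (Subgroup.mem_subgroupOf.mp hx)))
    (fun m hm g ↦ hfix m (fun i hi ↦ hm ⟨i, Subgroup.mem_top i⟩ (Subgroup.mem_subgroupOf.mpr hi)) g)
    (δ := ⟨δ, Subgroup.mem_top δ⟩) (Subgroup.mem_subgroupOf.mpr hδD)
    (eq_top_of_isOpen_subgroupOf_top (eq_top_of_isOpen_of_kerSubgroup_le_of_unitTwist κ hδ)) z ?_ ?_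
  · refine ⟨a, fun n hn ↦ ?_⟩
    have h := ha ⟨(n : absoluteGaloisGroup K), Subgroup.mem_subgroupOf.mp hn⟩
    have e : Subgroup.inclusion (le_top : κ.kerSubgroup ≤ ⊤)
        ⟨(n : absoluteGaloisGroup K), Subgroup.mem_subgroupOf.mp hn⟩ = n := Subtype.ext rfl
    rw [e] at h
    exact h
  · refine ⟨b, fun d hd ↦ ?_⟩
    have h := hb ⟨(d : absoluteGaloisGroup K), ⟨Subgroup.mem_top _, Subgroup.mem_subgroupOf.mp hd⟩⟩
    have e : Subgroup.inclusion (inf_le_left : ⊤ ⊓ decomp w ≤ ⊤)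
        ⟨(d : absoluteGaloisGroup K), ⟨Subgroup.mem_top _, Subgroup.mem_subgroupOf.mp hd⟩⟩ = d := Subtype.ext rfl
    rw [e] at h
    exact h

/-- **`𝔖_𝔮(K, M) ⊓ ker (res : H¹(K, M) → H¹(K_∞, M)) = ⊥`** under the hypotheses of
`eq_zero_of_resOfLe_kerSubgroup_eq_zero_of_resOfLe_decomp_eq_zero` at a place `w ∤ p`: the restricted Selmer condition at `w ∤ p`
is local triviality at (every conjugate of) `D_w` (`mem_restrictedSelmer_iff_resOfLe` with `σ = 1`). This is the KERNEL term of the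
control identity, for ANY distinguished `𝔮`. [cite: Agboola2007, §3 Prop. 3.2 (arXiv p0008:L128–135, L197)]
[cite: GreenbergLNM1716, §3 Lemma 3.1] -/
theorem restrictedSelmerBase_inf_ker_resOfLe_eq_bot (𝔮 : HeightOneSpectrum (𝓞 K))
    (hcont : ∀ m : M, Continuous fun g : absoluteGaloisGroup K ↦ g • m)
    (hpw : ((p : ℕ) : 𝓞 K) ∉ w.asIdeal) (hI : GreenbergSelmer.inertia w ≤ κ.kerSubgroup)
    (hfix : ∀ m : M, (∀ i ∈ GreenbergSelmer.inertia w, i • m = m) → ∀ g : absoluteGaloisGroup K, g • m = m)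
    (hsplit : ¬ decomp w ≤ κ.layerSubgroup 1) :
    restrictedSelmerBase M p 𝔮 ⊓ (resOfLe M (le_top : κ.kerSubgroup ≤ ⊤)).ker = ⊥ := by
  rw [eq_bot_iff]
  rintro c ⟨hc, hcker⟩
  rw [AddSubgroup.mem_bot]
  have hloc : resOfLe M (inf_le_left : ⊤ ⊓ decomp w ≤ ⊤) c = 0 := by
    have h := ((mem_restrictedSelmer_iff_resOfLe ⊤ M p 𝔮 c).mp hc).1 w hpw 1
    rwa [conjH1_one_holds (⊤ : Subgroup (absoluteGaloisGroup K)) M, AddMonoidHom.id_apply] at h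
  exact eq_zero_of_resOfLe_kerSubgroup_eq_zero_of_resOfLe_decomp_eq_zero κ M w hcont hI hfix hsplit hcker hloc

end Generic

/-! ## §3. Road α: `W*^{I_w} = W*[2]` is `Γ_K`-fixed at an additive `w ∤ 2`, so the kernel of control is `⊥` on every frame -/

section CM

open Summit.BirchSwinnertonDyer.BirchSwinnertonDyer.Theorems.PrintCf2.AdditiveAtSeven

variable (W : WeierstrassCurve ℚ) [W.IsElliptic] {K : Type} [Field K] [NumberField K]

/-- **`W*^{I_w} ⊆ W*^{Γ_K}` at an ADDITIVE `w ∤ 2`.** `W/ℚ` with `j = −3375`, `θ² = −7` in `K`, `π ∈ End_K(E_K)` with `π² = π − 2`,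
`r² = r − 2`, `M = W* = ↥((W.baseChange K).endEigenPrimaryTorsion 2 π r)`, `w ∤ 2` additive for `W_K`: every `I_w`-fixed element of
`W*` is fixed by ALL of `Γ_K` (`#E[2^∞]^{I_w} ≤ 4` by Greenberg's additive bound, and the ENGINE of p657641: the fixed module is
`W*[2]`, pointwise fixed since `√−7 ∈ K`). [cite: GreenbergLNM1716, §3 Lemma 3.3 (p. 88)] [cite: Rubin1999, §2 and Prop. 5.4] -/
theorem smul_eq_self_of_inertia_fixed_of_hasAdditiveReductionAt (hj : W.j = -3375) {θ : K} (hθ : θ ^ 2 = -7)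
    (π : (W.baseChange K).endRing) (hrel : (π : AddMonoid.End (W.baseChange K).geomPoints) * π = π - 2)
    {r : ℤ_[2]} (hr : r * r = r - 2) {w : HeightOneSpectrum (𝓞 K)} (h2w : ((2 : ℕ) : 𝓞 K) ∉ w.asIdeal)
    (hadd : (W.baseChange K).HasAdditiveReductionAt w)
    (m : ↥((W.baseChange K).endEigenPrimaryTorsion 2 π r)) (hm : ∀ i ∈ GreenbergSelmer.inertia w, i • m = m)
    (g : absoluteGaloisGroup K) : g • m = m := by
  haveI : (W.baseChange K).IsElliptic := by rw [baseChange]; infer_instance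
  obtain ⟨hfin, hle⟩ :=
    finite_and_natCard_fixedPoints_inertia_geomPrimaryTorsion_le_four (W.baseChange K) 2 h2w hadd
  haveI := hfin
  have hy : m ∈ FixedPoints.addSubgroup (GreenbergSelmer.inertia w) ↥((W.baseChange K).endEigenPrimaryTorsion 2 π r) :=
    (FixedPoints.mem_addSubgroup _ _ _).mpr fun s ↦ hm s s.2
  exact smul_eq_self_of_mem_fixedPoints_of_natCard_le_four W K hj hθ π hrel hr (GreenbergSelmer.inertia w) hle hy g

/-- **KERNEL-EXACT for the CM summand at an additive `w ∤ 2` not split in the first layer.** `W/ℚ` with `j = −3375`, `θ² = −7` in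
`K`, `π² = π − 2`, `r² = r − 2`, `κ` a `ℤ₂`-extension of `K` with `I_w ≤ ker κ` at an additive `w ∤ 2` such that `¬ D_w ≤ κ⁻¹(2ℤ₂)`:
for EVERY distinguished place `𝔮`, `𝔖_𝔮(K, W*) ⊓ ker (res : H¹(K, W*) → H¹(K_∞, W*)) = ⊥`.
[cite: Agboola2007, §3 Prop. 3.2 (arXiv p0008:L128–135)] [cite: GreenbergLNM1716, §3 Lemmas 3.1 and 3.3] -/
theorem restrictedSelmerBase_inf_ker_resOfLe_eq_bot_of_hasAdditiveReductionAt (hj : W.j = -3375) {θ : K}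
    (hθ : θ ^ 2 = -7) (π : (W.baseChange K).endRing)
    (hrel : (π : AddMonoid.End (W.baseChange K).geomPoints) * π = π - 2) {r : ℤ_[2]} (hr : r * r = r - 2)
    (κ : ZpExtension K 2) (𝔮 : HeightOneSpectrum (𝓞 K)) {w : HeightOneSpectrum (𝓞 K)}
    (hI : GreenbergSelmer.inertia w ≤ κ.kerSubgroup) (h2w : ((2 : ℕ) : 𝓞 K) ∉ w.asIdeal)
    (hadd : (W.baseChange K).HasAdditiveReductionAt w) (hsplit : ¬ decomp w ≤ κ.layerSubgroup 1) :
    restrictedSelmerBase ↥((W.baseChange K).endEigenPrimaryTorsion 2 π r) 2 𝔮 ⊓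
      (resOfLe ↥((W.baseChange K).endEigenPrimaryTorsion 2 π r) (le_top : κ.kerSubgroup ≤ ⊤)).ker = ⊥ :=
  restrictedSelmerBase_inf_ker_resOfLe_eq_bot κ ↥((W.baseChange K).endEigenPrimaryTorsion 2 π r) w 𝔮
    (continuous_smul_endEigenPrimaryTorsion (W.baseChange K) 2 π r) h2w hI
    (smul_eq_self_of_inertia_fixed_of_hasAdditiveReductionAt W hj hθ π hrel hr h2w hadd) hsplit

end CM

/-! ## §4. Every S3c₂ frame: (H7) at the place above `7` ⟹ the kernel term is `0`, and the identity loses it -/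

section Frame

open Summit.BirchSwinnertonDyer.BirchSwinnertonDyer.Theorems.PrintCf2.AdditiveAtSeven

variable {K : Type} [Field K] [NumberField K]

/-- **ROAD α: THE KERNEL OF CONTROL IS `⊥`** on every S3c₂ frame (member `C • W = cm7^{(d)}`, `K` imaginary quadratic, `v̄ ∣ 2`,
`π ∈ End_K(E_K)` with `π² = π − 2`, `r² = r − 2`, `κ′` unramified outside `v̄`; no `θ`-binder) GRANTED (H7): the place `w₇` above `7`
does NOT split completely in the first layer of `κ′` (`¬ D_{w₇} ≤ κ′⁻¹(2ℤ₂)`; true for the CFT line `K*_∞` of `ℚ(√−7)`, memo B15 §1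
(C2), not proved here). `w₇ ≠ v̄`, so `I_{w₇} ≤ ker κ′`; `W_K` is additive at `w₇` (p654052); §3 applies.
[cite: Agboola2007, §3 Prop. 3.2 (arXiv p0008:L128–135, L197)] [cite: GreenbergLNM1716, §3 Lemmas 3.1 and 3.3] -/
theorem ker_control_of_frame_eq_bot {d : ℤ} (hd0 : d ≠ 0) (W : WeierstrassCurve ℚ) [W.IsElliptic]
    (C : VariableChange ℚ) (hC : C • W = cm7.quadraticTwist (d : ℚ)) (hK : IsImaginaryQuadratic K)
    (vbar : HeightOneSpectrum (𝓞 K)) (hvbar : ((2 : ℕ) : 𝓞 K) ∈ vbar.asIdeal)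
    (π : (W.baseChange K).endRing) (hrel : (π : AddMonoid.End (W.baseChange K).geomPoints) * π = π - 2)
    {r : ℤ_[2]} (hr : r * r = r - 2) (κ' : ZpExtension K 2) (hκ' : κ'.IsUnramifiedOutside vbar)
    {w : HeightOneSpectrum (𝓞 K)} (h7 : ((7 : ℕ) : 𝓞 K) ∈ w.asIdeal) (hsplit : ¬ decomp w ≤ κ'.layerSubgroup 1) :
    restrictedSelmerBase ↥((W.baseChange K).endEigenPrimaryTorsion 2 π r) 2 vbar ⊓
      (resOfLe ↥((W.baseChange K).endEigenPrimaryTorsion 2 π r) (le_top : κ'.kerSubgroup ≤ ⊤)).ker = ⊥ := by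
  have hj : W.j = -3375 := j_eq_of_smul_eq_cm7Twist hd0 W C hC
  obtain ⟨θ, hθ⟩ := exists_sq_eq_neg_seven_of_cmEndo_mem_endRing W K hj π hrel
  have h2w : ((2 : ℕ) : 𝓞 K) ∉ w.asIdeal := natCast_two_notMem_of_seven_mem w h7
  have hw : w ≠ vbar := fun h ↦ h2w (h ▸ hvbar)
  exact restrictedSelmerBase_inf_ker_resOfLe_eq_bot_of_hasAdditiveReductionAt W hj hθ π hrel hr κ' vbar (hκ' w hw) h2w
    (hasAdditiveReductionAt_baseChange_of_j_eq_cm7_of_finrank_eq_two K w hK.1 W hj h7) hsplit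

/-- **`#ker = 1` and `v₂ #ker = 0`** on every S3c₂ frame granted (H7) at the place above `7` (the LEAD's `≤ 2`, `≤ 1` of p656507 made
exact). [cite: Agboola2007, §3 Prop. 3.2 (arXiv p0008:L197)] -/
theorem natCard_ker_control_of_frame_eq_one {d : ℤ} (hd0 : d ≠ 0) (W : WeierstrassCurve ℚ) [W.IsElliptic]
    (C : VariableChange ℚ) (hC : C • W = cm7.quadraticTwist (d : ℚ)) (hK : IsImaginaryQuadratic K)
    (vbar : HeightOneSpectrum (𝓞 K)) (hvbar : ((2 : ℕ) : 𝓞 K) ∈ vbar.asIdeal)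
    (π : (W.baseChange K).endRing) (hrel : (π : AddMonoid.End (W.baseChange K).geomPoints) * π = π - 2)
    {r : ℤ_[2]} (hr : r * r = r - 2) (κ' : ZpExtension K 2) (hκ' : κ'.IsUnramifiedOutside vbar)
    {w : HeightOneSpectrum (𝓞 K)} (h7 : ((7 : ℕ) : 𝓞 K) ∈ w.asIdeal) (hsplit : ¬ decomp w ≤ κ'.layerSubgroup 1) :
    Nat.card ↥(restrictedSelmerBase ↥((W.baseChange K).endEigenPrimaryTorsion 2 π r) 2 vbar ⊓
        (resOfLe ↥((W.baseChange K).endEigenPrimaryTorsion 2 π r) (le_top : κ'.kerSubgroup ≤ ⊤)).ker) = 1 ∧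
      padicValNat 2 (Nat.card ↥(restrictedSelmerBase ↥((W.baseChange K).endEigenPrimaryTorsion 2 π r) 2 vbar ⊓
        (resOfLe ↥((W.baseChange K).endEigenPrimaryTorsion 2 π r) (le_top : κ'.kerSubgroup ≤ ⊤)).ker)) = 0 := by
  have h := ker_control_of_frame_eq_bot hd0 W C hC hK vbar hvbar π hrel hr κ' hκ' h7 hsplit
  have h1 : Nat.card ↥(restrictedSelmerBase ↥((W.baseChange K).endEigenPrimaryTorsion 2 π r) 2 vbar ⊓
      (resOfLe ↥((W.baseChange K).endEigenPrimaryTorsion 2 π r) (le_top : κ'.kerSubgroup ≤ ⊤)).ker) = 1 := by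
    rw [h, AddSubgroup.card_bot]
  exact ⟨h1, by rw [h1, padicValNat_one_right]⟩

/-- **S3c₂'s four-index identity with BOTH the `𝔖_Γ` term and the kernel term GONE**: on every frame over `K ∋ √−7` (as in LEAD g11's
`control_identity_of_frame_of_noFiniteSubmodule`: member, `K` imaginary quadratic with `θ² = −7`, `v̄ ∣ 2`, `π² = π − 2`, `r² = r − 2`,
line `κ′` unramified outside `v̄` with generator `γ′`, dual datum `D` finitely generated with `HasCharValuationAt n` and NO nonzero
finite `Λ`-submodule) and granted (H7) at the place `w₇ ∣ 7` (`¬ D_{w₇} ≤ κ′⁻¹(2ℤ₂)`):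
**`n = v₂ #𝔖_{v̄}(K, W*) + v₂ [𝔖_{v̄}(K*_∞, W*)^Γ : res 𝔖_{v̄}(K, W*)]`** — what S3c₂ still asserts is the bottom value, the
cokernel index and the two structural hypotheses. [cite: Agboola2007, §3 Prop. 3.2, §5, §6, Prop. 8.1]
[cite: GreenbergLNM1716, §4 Lemma 4.2, Prop. 4.15] -/
theorem control_identity_of_frame_of_not_decomp_le {d : ℤ} (hd0 : d ≠ 0) (W : WeierstrassCurve ℚ) [W.IsElliptic]
    (C : VariableChange ℚ) (hC : C • W = cm7.quadraticTwist (d : ℚ)) (hK : IsImaginaryQuadratic K) {θ : K} (hθ : θ ^ 2 = -7)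
    (vbar : HeightOneSpectrum (𝓞 K)) (hvbar : ((2 : ℕ) : 𝓞 K) ∈ vbar.asIdeal)
    (π : (W.baseChange K).endRing) (hrel : (π : AddMonoid.End (W.baseChange K).geomPoints) * π = π - 2)
    {r : ℤ_[2]} (hr : r * r = r - 2) (κ' : ZpExtension K 2) (hκ' : κ'.IsUnramifiedOutside vbar)
    {γ' : absoluteGaloisGroup K} (hγ' : κ'.IsTopGenerator γ')
    (D : RestrictedDualData κ' ↥((W.baseChange K).endEigenPrimaryTorsion 2 π r) vbar γ')
    [Module.Finite (IwasawaAlgebra 2) D.X] {n : ℕ} (hD : D.HasCharValuationAt n)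
    (hY : ∀ N : Submodule (IwasawaAlgebra 2) D.X, Finite N → N = ⊥)
    {w : HeightOneSpectrum (𝓞 K)} (h7 : ((7 : ℕ) : 𝓞 K) ∈ w.asIdeal) (hsplit : ¬ decomp w ≤ κ'.layerSubgroup 1) :
    Nat.card (EndCoinvariants (conjRestricted κ' ↥((W.baseChange K).endEigenPrimaryTorsion 2 π r) vbar γ' - 1)) = 1 ∧
    Nat.card ↥(restrictedSelmerBase ↥((W.baseChange K).endEigenPrimaryTorsion 2 π r) 2 vbar ⊓
        (resOfLe ↥((W.baseChange K).endEigenPrimaryTorsion 2 π r) (le_top : κ'.kerSubgroup ≤ ⊤)).ker) = 1 ∧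
      (n : ℕ) =
        padicValNat 2 (Nat.card (restrictedSelmerBase ↥((W.baseChange K).endEigenPrimaryTorsion 2 π r) 2 vbar)) +
          padicValNat 2 ((((restrictedSelmerBase ↥((W.baseChange K).endEigenPrimaryTorsion 2 π r) 2 vbar).map
              (resOfLe ↥((W.baseChange K).endEigenPrimaryTorsion 2 π r) (le_top : κ'.kerSubgroup ≤ ⊤))).addSubgroupOf
              (restrictedSelmerZp κ' ↥((W.baseChange K).endEigenPrimaryTorsion 2 π r) vbar)).relIndex
            (endInvariants (conjRestricted κ' ↥((W.baseChange K).endEigenPrimaryTorsion 2 π r) vbar γ' - 1))) := by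
  obtain ⟨h1, -, hid⟩ :=
    control_identity_of_frame_of_noFiniteSubmodule hd0 W C hC hK hθ vbar hvbar π hrel hr κ' hκ' hγ' D hD hY
  obtain ⟨hk1, hk0⟩ := natCard_ker_control_of_frame_eq_one hd0 W C hC hK vbar hvbar π hrel hr κ' hκ' h7 hsplit
  refine ⟨h1, hk1, ?_⟩
  rw [hk0, add_zero] at hid
  exact hid

end Frame

end Summit.BirchSwinnertonDyer.BirchSwinnertonDyer.Theorems.PrintCf2.RestrictedSelmerPair

end
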